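import Literature.NumberTheory.Weil1964.UnitaryArchLocalTopFormHaar             -- ★ U1 FILE B (A-p06 g28): `skewC`, `cayleySourceC`, `lieStdLebesgueC`, `cayleyWeightC`, `localTopFormHaar`
import Literature.NumberTheory.Automorphic.UnitaryGroupFormTransport             -- ★ `formCongr`, `formCongr_inv_formCongr`
import HarnessLib

/-!
# `Ad T : 𝔲(J₂) ≃ 𝔲(J)` for a congruence `Tᴴ J T = J₂` over `ℂ` preserves the trace-form Lebesgue measure and the Cayley weight; the window-free integral
# `∫ w₀ dλ` (the top-form volume) is a congruence invariant ((U) road, U4-DISCHARGE (cpt) half, LEAD F0P3a-plan (g10) WORD T9-40 (d2); one-place replica of ★ B1″-C §1; Rogawski 1990 §1.7)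

Topic `NumberTheory/Weil1964`; namespace `Literature.NumberTheory.Weil1964.UnitaryArchLocalTopForm` (home of ★ U1 FILE B).  THEOREMS ONLY (no `def`, no instance, no notation,
no axiom, no named fact, no `sorry`).  Cell `pub/hodgecm-mathlib`, crux H413 = `stmt-HodgeConjecture-24833` (supports only).  Count-neutral plumbing.  HONEST LABEL: HC_CM is
proved only modulo the printed citations until rung 0 closes; this file serves the later in-house DISCHARGE of U4 `ArchTopFormWallCompatible` (★ p844462, route-side), whose
(cpt) clause asks ONE mass `V = vol^TF(U(σ_w diag(β₀,β₂))(ℂ)) · vol^TF(U(σ_w β₁)(ℂ))` for ALL same-sign real diagonal carriers `β` at ALL complex places `w`: all such one-place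
groups are `GL(ℂ)`-CONGRUENT, so what is needed is that the top-form volume is a congruence invariant.  This is §1 of ★ B1″-C `UnitaryArchTopFormHaarCongr` (A-p19 (g21)) READ
AT ONE PLACE (`M_N(E ⊗ ℝ) ↦ M_N(ℂ)`, `σ ↦ conj`, `archSkew ↦ skewC`, …), plus the window-free integral identity:

* §0 matrix algebra over `ℂ`: `conj_mem_skewC` (`T X T⁻¹ ∈ 𝔲(J)` for `X ∈ 𝔲(J₂)`), `traceFormC_conj`, `cayleyC_conj`.
* §1 `exists_conjEquivC` (`e = Ad T : 𝔲(J₂) ≃L[ℝ] 𝔲(J)`), `conjEquivC_symm_apply`, `conj_mem_cayleySourceC` ∕ `conj_symm_mem_cayleySourceC` ∕ `image_conjEquivC_cayleySourceC`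
  (the Cayley sources correspond), `det_skewMulLC_conj`, **`cayleyWeightC_conj`** (`w₀^J(T X T⁻¹) = w₀^{J₂}(X)`), `lieGramC_map_conjEquiv`, `det_lieGramC_ne_zero_iff`,
  `lieGramDetC_ne_zero_iff_of_conj`, **`map_conjEquiv_lieStdLebesgueC`** (`e_* λ_{J₂} = λ_J`), **`lintegral_cayleyWeightC_eq_of_conj`** and
  **`setLIntegral_cayleyWeightC_cayleySourceC_eq_of_conj`** (`∫⁻ w₀^J dλ_J = ∫⁻ w₀^{J₂} dλ_{J₂}`, on `𝔲` and on the sources), and the hypothesis-form corollary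
  **`localTopFormHaar_univ_eq_of_conj_of_mass`**: if `vol^TF = ∫⁻_{source} w₀ dλ` for `J` and `J₂` (U4-discharge piece (ii), A-p06 (g29)), congruent `J, J₂` have the same volume.
The sequel `UnitaryArchLocalTopFormHaarCongr` carries chart measures and — modulo the window identities — `localTopFormHaar` itself.

## References
* [Rogawski1990] J. D. Rogawski, *Automorphic Representations of Unitary Groups in Three Variables*, Ann. of Math. Stud. 123 (1990), §1.7 p. 6 («`dg′ = |ψ^*Ω|`»).
* [Helgason2000] S. Helgason, *Groups and Geometric Analysis*, AMS Math. Surveys Monogr. 83 (2000), Ch. I §1 Thm. 1.14 p. 96.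
* [Macdonald1980] I. G. Macdonald, *The volume of a compact Lie group*, Invent. Math. 56 (1980), p. 93.
* [Knapp2002] A. W. Knapp, *Lie Groups Beyond an Introduction*, 2nd ed. (2002), I §1, VIII §2.
* [Weyl1939] H. Weyl, *The Classical Groups* (1939), Ch. II §10 (Cayley parametrisation).
-/

set_option autoImplicit false
-- the scoped normed structure on the submodule `𝔲(Jw) ≤ M_N(ℂ)` vs the `[BorelSpace ↥(skewC …)]` binder's subtype topology (as in ★ U1 FILE B ∕ ★ B1″-C)
set_option backward.isDefEq.respectTransparency false

noncomputable section

open Set Filter Topology MeasureTheory MeasureTheory.Measure Literature.Analysis.Calculus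
open scoped Classical Matrix Matrix.Norms.Operator MatrixGroups ENNReal NNReal Pointwise

namespace Literature.NumberTheory.Weil1964

namespace UnitaryArchLocalTopForm

open Literature.NumberTheory.Automorphic Literature.NumberTheory.Automorphic.UnitaryGroup

/-! ## §0 Matrix algebra over `ℂ`: conjugation carries `𝔲(J₂)` to `𝔲(J)`, preserves the trace form, commutes with the Cayley transform -/

section Algebra

variable {N : ℕ} {Jw Jw₂ : Matrix (Fin N) (Fin N) ℂ}

/-- `σ(T)ᵀ = Tᴴ` over `ℂ` (entrywise `conj`, definitional). [cite: Knapp2002, I §1] -/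
theorem transpose_map_starRingEnd (M : Matrix (Fin N) (Fin N) ℂ) : (M.map (starRingEnd ℂ))ᵀ = Mᴴ := Matrix.ext fun _ _ => rfl

/-- `T (1 + X) T⁻¹ = 1 + T X T⁻¹`. [cite: Knapp2002, I §1] -/
theorem conjC_one_add (T : GL (Fin N) ℂ) (X : Matrix (Fin N) (Fin N) ℂ) :
    (T : Matrix (Fin N) (Fin N) ℂ) * (1 + X) * ((T⁻¹ : GL (Fin N) ℂ) : Matrix (Fin N) (Fin N) ℂ) = 1 + (T : Matrix (Fin N) (Fin N) ℂ) * X * ((T⁻¹ : GL (Fin N) ℂ) : Matrix (Fin N) (Fin N) ℂ) := by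
  have hTT : (T : Matrix (Fin N) (Fin N) ℂ) * ((T⁻¹ : GL (Fin N) ℂ) : Matrix (Fin N) (Fin N) ℂ) = 1 := by rw [← Units.val_mul, mul_inv_cancel, Units.val_one]
  rw [Matrix.mul_add, Matrix.add_mul, Matrix.mul_one, hTT]

/-- `T (1 − X) T⁻¹ = 1 − T X T⁻¹`. [cite: Knapp2002, I §1] -/
theorem conjC_one_sub (T : GL (Fin N) ℂ) (X : Matrix (Fin N) (Fin N) ℂ) :
    (T : Matrix (Fin N) (Fin N) ℂ) * (1 - X) * ((T⁻¹ : GL (Fin N) ℂ) : Matrix (Fin N) (Fin N) ℂ) = 1 - (T : Matrix (Fin N) (Fin N) ℂ) * X * ((T⁻¹ : GL (Fin N) ℂ) : Matrix (Fin N) (Fin N) ℂ) := by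
  have hTT : (T : Matrix (Fin N) (Fin N) ℂ) * ((T⁻¹ : GL (Fin N) ℂ) : Matrix (Fin N) (Fin N) ℂ) = 1 := by rw [← Units.val_mul, mul_inv_cancel, Units.val_one]
  rw [Matrix.mul_sub, Matrix.sub_mul, Matrix.mul_one, hTT]

/-- **Conjugation carries the Lie algebras**: if `Tᴴ J T = J₂` (★ `formCongr` for `σ = conj`) and `X ∈ 𝔲(J₂)` then `T X T⁻¹ ∈ 𝔲(J)` (the one-place replica of ★ `conj_mem_archSkew`).
[cite: Knapp2002, I §1] [cite: Rogawski1990, §1.7 p. 6] -/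
theorem conj_mem_skewC {T : GL (Fin N) ℂ} (h : formCongr (starRingEnd ℂ) T Jw = Jw₂) {X : Matrix (Fin N) (Fin N) ℂ} (hX : X ∈ skewC N Jw₂) :
    (T : Matrix (Fin N) (Fin N) ℂ) * X * ((T⁻¹ : GL (Fin N) ℂ) : Matrix (Fin N) (Fin N) ℂ) ∈ skewC N Jw := by
  rw [mem_skewC_iff] at hX ⊢
  set Tm : Matrix (Fin N) (Fin N) ℂ := (T : Matrix (Fin N) (Fin N) ℂ) with hTm
  set Ti : Matrix (Fin N) (Fin N) ℂ := ((T⁻¹ : GL (Fin N) ℂ) : Matrix (Fin N) (Fin N) ℂ) with hTi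
  have hTT : Tm * Ti = 1 := by rw [hTm, hTi, ← Units.val_mul, mul_inv_cancel, Units.val_one]
  have hSS : Tiᴴ * Tmᴴ = 1 := by rw [← Matrix.conjTranspose_mul, hTT, Matrix.conjTranspose_one]
  have hJ₂ : Jw₂ = Tmᴴ * Jw * Tm := by rw [← h, formCongr, transpose_map_starRingEnd]
  rw [hJ₂] at hX
  have key := congrArg (fun A => Tiᴴ * A * Ti) hX
  simp only [mul_add, add_mul, Matrix.mul_zero, Matrix.zero_mul] at key
  rw [Matrix.conjTranspose_mul, Matrix.conjTranspose_mul]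
  have e1 : Tiᴴ * (Xᴴ * (Tmᴴ * Jw * Tm)) * Ti = Tiᴴ * Xᴴ * Tmᴴ * Jw := by
    simp only [Matrix.mul_assoc, hTT, Matrix.mul_one]
  have e2 : Tiᴴ * (Tmᴴ * Jw * Tm * X) * Ti = Jw * (Tm * X * Ti) := by
    rw [show Tiᴴ * (Tmᴴ * Jw * Tm * X) * Ti = (Tiᴴ * Tmᴴ) * (Jw * (Tm * X * Ti)) by simp only [Matrix.mul_assoc], hSS, Matrix.one_mul]
  rw [e1, e2] at key
  simpa only [Matrix.mul_assoc] using key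

/-- **The trace form is conjugation-invariant**: `β(T X T⁻¹, T Y T⁻¹) = β(X, Y)`, `β(X, Y) = Re tr(XY)`. [cite: Macdonald1980, p. 93] -/
theorem traceFormC_conj (T : GL (Fin N) ℂ) (X Y : Matrix (Fin N) (Fin N) ℂ) :
    traceFormC N ((T : Matrix (Fin N) (Fin N) ℂ) * X * ((T⁻¹ : GL (Fin N) ℂ) : Matrix (Fin N) (Fin N) ℂ)) ((T : Matrix (Fin N) (Fin N) ℂ) * Y * ((T⁻¹ : GL (Fin N) ℂ) : Matrix (Fin N) (Fin N) ℂ)) =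
      traceFormC N X Y := by
  have hTT : ((T⁻¹ : GL (Fin N) ℂ) : Matrix (Fin N) (Fin N) ℂ) * (T : Matrix (Fin N) (Fin N) ℂ) = 1 := by rw [← Units.val_mul, inv_mul_cancel, Units.val_one]
  set Tm : Matrix (Fin N) (Fin N) ℂ := (T : Matrix (Fin N) (Fin N) ℂ) with hTm
  set Ti : Matrix (Fin N) (Fin N) ℂ := ((T⁻¹ : GL (Fin N) ℂ) : Matrix (Fin N) (Fin N) ℂ) with hTi
  have hprod : Tm * X * Ti * (Tm * Y * Ti) = Tm * (X * Y) * Ti := by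
    simp only [Matrix.mul_assoc]
    rw [← Matrix.mul_assoc Ti Tm (Y * Ti), hTT, Matrix.one_mul]
  rw [traceFormC_apply, traceFormC_apply, hprod, Matrix.trace_mul_cycle, hTT, Matrix.one_mul]

/-- **The Cayley transform is conjugation-equivariant**: `c(T X T⁻¹) = T c(X) T⁻¹` for `1 + X` a unit. [cite: Weyl1939, Ch. II §10] -/
theorem cayleyC_conj (T : GL (Fin N) ℂ) {X : Matrix (Fin N) (Fin N) ℂ} (hX : IsUnit (1 + X)) :
    cayley ((T : Matrix (Fin N) (Fin N) ℂ) * X * ((T⁻¹ : GL (Fin N) ℂ) : Matrix (Fin N) (Fin N) ℂ)) =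
      (T : Matrix (Fin N) (Fin N) ℂ) * cayley X * ((T⁻¹ : GL (Fin N) ℂ) : Matrix (Fin N) (Fin N) ℂ) := by
  obtain ⟨u, hu⟩ := hX
  set Tm : Matrix (Fin N) (Fin N) ℂ := (T : Matrix (Fin N) (Fin N) ℂ) with hTm
  set Ti : Matrix (Fin N) (Fin N) ℂ := ((T⁻¹ : GL (Fin N) ℂ) : Matrix (Fin N) (Fin N) ℂ) with hTi
  have hTT : Tm * Ti = 1 := by rw [hTm, hTi, ← Units.val_mul, mul_inv_cancel, Units.val_one]
  have h1 : 1 + Tm * X * Ti = ((T * u * T⁻¹ : (Matrix (Fin N) (Fin N) ℂ)ˣ) : Matrix (Fin N) (Fin N) ℂ) := by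
    rw [Units.val_mul, Units.val_mul, hu, ← hTm, ← hTi, Matrix.mul_add, Matrix.add_mul, Matrix.mul_one, hTT]
  have h2 : 1 - Tm * X * Ti = Tm * (1 - X) * Ti := by rw [Matrix.mul_sub, Matrix.sub_mul, Matrix.mul_one, hTT]
  rw [cayley_def, cayley_def, h1, Ring.inverse_unit, h2, ← hu, Ring.inverse_unit, mul_inv_rev, mul_inv_rev, inv_inv, Units.val_mul, Units.val_mul, ← hTm, ← hTi]
  simp only [Matrix.mul_assoc]
  rw [← Matrix.mul_assoc Ti Tm, show Ti * Tm = 1 by rw [hTm, hTi, ← Units.val_mul, inv_mul_cancel, Units.val_one], Matrix.one_mul]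

end Algebra

/-! ## §1 `Ad T` on the Lie algebras: the trace form, the Jacobian weight and the canonical Lebesgue measure are transported -/

section Ad

variable {N : ℕ} {Jw Jw₂ : Matrix (Fin N) (Fin N) ℂ}

/-- `Ad T` as an `ℝ`-linear map `𝔲(J₂) → 𝔲(J)` when `Tᴴ J T = J₂`. [cite: Knapp2002, I §1] -/
theorem exists_conjLinearMapC {T : GL (Fin N) ℂ} (h : formCongr (starRingEnd ℂ) T Jw = Jw₂) :
    ∃ f : skewC N Jw₂ →ₗ[ℝ] skewC N Jw, ∀ X : skewC N Jw₂,
      ((f X : skewC N Jw) : Matrix (Fin N) (Fin N) ℂ) = (T : Matrix (Fin N) (Fin N) ℂ) * (X : Matrix (Fin N) (Fin N) ℂ) * ((T⁻¹ : GL (Fin N) ℂ) : Matrix (Fin N) (Fin N) ℂ) :=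
  ⟨((LinearMap.mulLeftRight ℝ ((T : Matrix (Fin N) (Fin N) ℂ), ((T⁻¹ : GL (Fin N) ℂ) : Matrix (Fin N) (Fin N) ℂ))).comp (skewC N Jw₂).subtype).codRestrict
      (skewC N Jw) fun X => conj_mem_skewC h X.2,
    fun _ => rfl⟩

/-- **`Ad T : 𝔲(J₂) ≃L[ℝ] 𝔲(J)`** when `Tᴴ J T = J₂`: a continuous linear isomorphism `e` with `e X = T X T⁻¹` (inverse `Ad T⁻¹`, ★ `formCongr_inv_formCongr`).
[cite: Knapp2002, I §1] [cite: Rogawski1990, §1.7 p. 6] -/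
theorem exists_conjEquivC {T : GL (Fin N) ℂ} (h : formCongr (starRingEnd ℂ) T Jw = Jw₂) :
    ∃ e : skewC N Jw₂ ≃L[ℝ] skewC N Jw, ∀ X : skewC N Jw₂,
      ((e X : skewC N Jw) : Matrix (Fin N) (Fin N) ℂ) = (T : Matrix (Fin N) (Fin N) ℂ) * (X : Matrix (Fin N) (Fin N) ℂ) * ((T⁻¹ : GL (Fin N) ℂ) : Matrix (Fin N) (Fin N) ℂ) := by
  haveI : FiniteDimensional ℝ (Matrix (Fin N) (Fin N) ℂ) := finiteDimensional_matrixC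
  have h' : formCongr (starRingEnd ℂ) T⁻¹ Jw₂ = Jw := by rw [← h, formCongr_inv_formCongr]
  obtain ⟨f, hf⟩ := exists_conjLinearMapC (Jw := Jw) (Jw₂ := Jw₂) h
  obtain ⟨g, hg⟩ := exists_conjLinearMapC (Jw := Jw₂) (Jw₂ := Jw) h'
  simp only [inv_inv] at hg
  have hTT : (T : Matrix (Fin N) (Fin N) ℂ) * ((T⁻¹ : GL (Fin N) ℂ) : Matrix (Fin N) (Fin N) ℂ) = 1 := by rw [← Units.val_mul, mul_inv_cancel, Units.val_one]
  have hTT' : ((T⁻¹ : GL (Fin N) ℂ) : Matrix (Fin N) (Fin N) ℂ) * (T : Matrix (Fin N) (Fin N) ℂ) = 1 := by rw [← Units.val_mul, inv_mul_cancel, Units.val_one]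
  have h₁ : f ∘ₗ g = LinearMap.id := by
    apply LinearMap.ext
    intro Y
    apply Subtype.ext
    rw [LinearMap.comp_apply, hf, hg, LinearMap.id_apply]
    simp only [Matrix.mul_assoc, hTT, Matrix.mul_one]
    rw [← Matrix.mul_assoc, hTT, Matrix.one_mul]
  have h₂ : g ∘ₗ f = LinearMap.id := by
    apply LinearMap.ext
    intro X
    apply Subtype.ext
    rw [LinearMap.comp_apply, hg, hf, LinearMap.id_apply]
    simp only [Matrix.mul_assoc, hTT', Matrix.mul_one]
    rw [← Matrix.mul_assoc, hTT', Matrix.one_mul]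
  exact ⟨(LinearEquiv.ofLinear f g h₁ h₂).toContinuousLinearEquiv, fun X => hf X⟩

/-- The inverse of `Ad T` is `Ad T⁻¹`: `e⁻¹ Y = T⁻¹ Y T`. [cite: Knapp2002, I §1] -/
theorem conjEquivC_symm_apply {T : GL (Fin N) ℂ} (e : skewC N Jw₂ ≃L[ℝ] skewC N Jw)
    (he : ∀ X : skewC N Jw₂, ((e X : skewC N Jw) : Matrix (Fin N) (Fin N) ℂ) = (T : Matrix (Fin N) (Fin N) ℂ) * (X : Matrix (Fin N) (Fin N) ℂ) * ((T⁻¹ : GL (Fin N) ℂ) : Matrix (Fin N) (Fin N) ℂ))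
    (Y : skewC N Jw) :
    ((e.symm Y : skewC N Jw₂) : Matrix (Fin N) (Fin N) ℂ) = ((T⁻¹ : GL (Fin N) ℂ) : Matrix (Fin N) (Fin N) ℂ) * (Y : Matrix (Fin N) (Fin N) ℂ) * (T : Matrix (Fin N) (Fin N) ℂ) := by
  have hTT' : ((T⁻¹ : GL (Fin N) ℂ) : Matrix (Fin N) (Fin N) ℂ) * (T : Matrix (Fin N) (Fin N) ℂ) = 1 := by rw [← Units.val_mul, inv_mul_cancel, Units.val_one]
  have hY : (Y : Matrix (Fin N) (Fin N) ℂ) = (T : Matrix (Fin N) (Fin N) ℂ) * ((e.symm Y : skewC N Jw₂) : Matrix (Fin N) (Fin N) ℂ) * ((T⁻¹ : GL (Fin N) ℂ) : Matrix (Fin N) (Fin N) ℂ) := by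
    rw [← he (e.symm Y), e.apply_symm_apply]
  rw [hY]
  simp only [Matrix.mul_assoc, hTT', Matrix.mul_one]
  rw [← Matrix.mul_assoc, hTT', Matrix.one_mul]

/-- `Ad T` carries the Cayley source of `𝔲(J₂)` into the Cayley source of `𝔲(J)` (`1 ± T X T⁻¹ = T (1 ± X) T⁻¹`). [cite: Weyl1939, Ch. II §10] -/
theorem conj_mem_cayleySourceC {T : GL (Fin N) ℂ} (e : skewC N Jw₂ ≃L[ℝ] skewC N Jw)
    (he : ∀ X : skewC N Jw₂, ((e X : skewC N Jw) : Matrix (Fin N) (Fin N) ℂ) = (T : Matrix (Fin N) (Fin N) ℂ) * (X : Matrix (Fin N) (Fin N) ℂ) * ((T⁻¹ : GL (Fin N) ℂ) : Matrix (Fin N) (Fin N) ℂ))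
    {X : skewC N Jw₂} (hX : X ∈ cayleySourceC N Jw₂) : e X ∈ cayleySourceC N Jw := by
  obtain ⟨u, hu⟩ := hX.1
  obtain ⟨v, hv⟩ := hX.2
  rw [mem_cayleySourceC_iff, he, ← conjC_one_add, ← conjC_one_sub, ← hu, ← hv, ← Units.val_mul, ← Units.val_mul, ← Units.val_mul, ← Units.val_mul]
  exact ⟨Units.isUnit _, Units.isUnit _⟩

/-- Conversely `Ad T⁻¹` carries the source of `𝔲(J)` into the source of `𝔲(J₂)`: `e⁻¹ Y ∈ source` for `Y ∈ source`. [cite: Weyl1939, Ch. II §10] -/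
theorem conj_symm_mem_cayleySourceC {T : GL (Fin N) ℂ} (e : skewC N Jw₂ ≃L[ℝ] skewC N Jw)
    (he : ∀ X : skewC N Jw₂, ((e X : skewC N Jw) : Matrix (Fin N) (Fin N) ℂ) = (T : Matrix (Fin N) (Fin N) ℂ) * (X : Matrix (Fin N) (Fin N) ℂ) * ((T⁻¹ : GL (Fin N) ℂ) : Matrix (Fin N) (Fin N) ℂ))
    {Y : skewC N Jw} (hY : Y ∈ cayleySourceC N Jw) : e.symm Y ∈ cayleySourceC N Jw₂ := by
  obtain ⟨u, hu⟩ := hY.1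
  obtain ⟨v, hv⟩ := hY.2
  have he' : ∀ Y : skewC N Jw, ((e.symm Y : skewC N Jw₂) : Matrix (Fin N) (Fin N) ℂ) =
      ((T⁻¹ : GL (Fin N) ℂ) : Matrix (Fin N) (Fin N) ℂ) * (Y : Matrix (Fin N) (Fin N) ℂ) * (((T⁻¹)⁻¹ : GL (Fin N) ℂ) : Matrix (Fin N) (Fin N) ℂ) := fun Y => by
    rw [inv_inv]; exact conjEquivC_symm_apply e he Y
  rw [mem_cayleySourceC_iff, he', ← conjC_one_add, ← conjC_one_sub, ← hu, ← hv, ← Units.val_mul, ← Units.val_mul, ← Units.val_mul, ← Units.val_mul]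
  exact ⟨Units.isUnit _, Units.isUnit _⟩

/-- `Ad T` maps the Cayley source of `𝔲(J₂)` ONTO the Cayley source of `𝔲(J)`. [cite: Weyl1939, Ch. II §10] -/
theorem image_conjEquivC_cayleySourceC {T : GL (Fin N) ℂ} (e : skewC N Jw₂ ≃L[ℝ] skewC N Jw)
    (he : ∀ X : skewC N Jw₂, ((e X : skewC N Jw) : Matrix (Fin N) (Fin N) ℂ) = (T : Matrix (Fin N) (Fin N) ℂ) * (X : Matrix (Fin N) (Fin N) ℂ) * ((T⁻¹ : GL (Fin N) ℂ) : Matrix (Fin N) (Fin N) ℂ)) :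
    e '' cayleySourceC N Jw₂ = cayleySourceC N Jw := by
  apply Set.Subset.antisymm
  · rintro _ ⟨X, hX, rfl⟩
    exact conj_mem_cayleySourceC e he hX
  · intro Y hY
    exact ⟨e.symm Y, conj_symm_mem_cayleySourceC e he hY, e.apply_symm_apply Y⟩

/-- **`Ad T` CONJUGATES THE JACOBIAN MAPS**: `det m_{e Y}|_{𝔲(J)} = det m_Y|_{𝔲(J₂)}` (`m_{eY} = e ∘ m_Y ∘ e⁻¹`, Mathlib `LinearMap.det_conj`).
[cite: Helgason2000, Ch. I §1 Thm. 1.14 p. 96] [cite: Weyl1939, Ch. II §10] -/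
theorem det_skewMulLC_conj {T : GL (Fin N) ℂ} (e : skewC N Jw₂ ≃L[ℝ] skewC N Jw)
    (he : ∀ X : skewC N Jw₂, ((e X : skewC N Jw) : Matrix (Fin N) (Fin N) ℂ) = (T : Matrix (Fin N) (Fin N) ℂ) * (X : Matrix (Fin N) (Fin N) ℂ) * ((T⁻¹ : GL (Fin N) ℂ) : Matrix (Fin N) (Fin N) ℂ))
    (Y : skewC N Jw₂) :
    (skewMulLC N Jw (e Y)).det = (skewMulLC N Jw₂ Y).det := by
  have key : ((skewMulLC N Jw (e Y) : skewC N Jw →L[ℝ] skewC N Jw) : skewC N Jw →ₗ[ℝ] skewC N Jw) =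
      (e.toLinearEquiv : skewC N Jw₂ →ₗ[ℝ] skewC N Jw) ∘ₗ ((skewMulLC N Jw₂ Y : skewC N Jw₂ →L[ℝ] skewC N Jw₂) : skewC N Jw₂ →ₗ[ℝ] skewC N Jw₂) ∘ₗ
        (e.toLinearEquiv.symm : skewC N Jw →ₗ[ℝ] skewC N Jw₂) := by
    apply LinearMap.ext
    intro H
    apply Subtype.ext
    have e1 : ((((skewMulLC N Jw (e Y) : skewC N Jw →L[ℝ] skewC N Jw) : skewC N Jw →ₗ[ℝ] skewC N Jw) H : skewC N Jw) : Matrix (Fin N) (Fin N) ℂ) =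
        (1 - ((e Y : skewC N Jw) : Matrix (Fin N) (Fin N) ℂ)) * (H : Matrix (Fin N) (Fin N) ℂ) * (1 + ((e Y : skewC N Jw) : Matrix (Fin N) (Fin N) ℂ)) := rfl
    have e2 : ((((e.toLinearEquiv : skewC N Jw₂ →ₗ[ℝ] skewC N Jw) ∘ₗ ((skewMulLC N Jw₂ Y : skewC N Jw₂ →L[ℝ] skewC N Jw₂) : skewC N Jw₂ →ₗ[ℝ] skewC N Jw₂) ∘ₗ
          (e.toLinearEquiv.symm : skewC N Jw →ₗ[ℝ] skewC N Jw₂)) H : skewC N Jw) : Matrix (Fin N) (Fin N) ℂ) =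
        ((e (skewMulLC N Jw₂ Y (e.symm H)) : skewC N Jw) : Matrix (Fin N) (Fin N) ℂ) := rfl
    rw [e1, e2, he, he, coe_skewMulLC_apply, conjEquivC_symm_apply e he H, ← conjC_one_add T, ← conjC_one_sub T]
    have hTT' : ((T⁻¹ : GL (Fin N) ℂ) : Matrix (Fin N) (Fin N) ℂ) * (T : Matrix (Fin N) (Fin N) ℂ) = 1 := by rw [← Units.val_mul, inv_mul_cancel, Units.val_one]
    simp only [Matrix.mul_assoc]
  change LinearMap.det _ = LinearMap.det _
  rw [key, LinearMap.det_conj]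

/-- **THE CAYLEY WEIGHT IS `Ad T`-INVARIANT**: `w₀^{J}(T Y T⁻¹) = w₀^{J₂}(Y)`. [cite: Helgason2000, Ch. I §1 Thm. 1.14 p. 96] [cite: Weyl1939, Ch. II §10] -/
theorem cayleyWeightC_conj {T : GL (Fin N) ℂ} (e : skewC N Jw₂ ≃L[ℝ] skewC N Jw)
    (he : ∀ X : skewC N Jw₂, ((e X : skewC N Jw) : Matrix (Fin N) (Fin N) ℂ) = (T : Matrix (Fin N) (Fin N) ℂ) * (X : Matrix (Fin N) (Fin N) ℂ) * ((T⁻¹ : GL (Fin N) ℂ) : Matrix (Fin N) (Fin N) ℂ))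
    (Y : skewC N Jw₂) :
    cayleyWeightC N Jw (e Y) = cayleyWeightC N Jw₂ Y := by
  rw [cayleyWeightC_def, cayleyWeightC_def, det_skewMulLC_conj e he]

/-- **THE GRAM MATRIX IS `Ad T`-INVARIANT**: for a basis `B` of `𝔲(J₂)`, the transported basis `e ∘ B` of `𝔲(J)` has the same Gram matrix. [cite: Macdonald1980, p. 93] -/
theorem lieGramC_map_conjEquiv {T : GL (Fin N) ℂ} (e : skewC N Jw₂ ≃L[ℝ] skewC N Jw)
    (he : ∀ X : skewC N Jw₂, ((e X : skewC N Jw) : Matrix (Fin N) (Fin N) ℂ) = (T : Matrix (Fin N) (Fin N) ℂ) * (X : Matrix (Fin N) (Fin N) ℂ) * ((T⁻¹ : GL (Fin N) ℂ) : Matrix (Fin N) (Fin N) ℂ))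
    {ι : Type} (B : Module.Basis ι ℝ (skewC N Jw₂)) :
    lieGramC (B.map e.toLinearEquiv) = lieGramC B := by
  ext i j
  rw [lieGramC_apply, lieGramC_apply, Module.Basis.map_apply, Module.Basis.map_apply, ContinuousLinearEquiv.coe_toLinearEquiv, he, he, traceFormC_conj]

/-- **Non-degeneracy of the trace form is basis-free**: for EVERY finite basis `B` of `𝔲(J)`, `det Gram(B) ≠ 0 ↔ lieGramDetC ≠ 0`. [cite: Macdonald1980, p. 93] [cite: Knapp2002, VIII §2] -/
theorem det_lieGramC_ne_zero_iff {ι : Type} [Fintype ι] (B : Module.Basis ι ℝ (skewC N Jw)) :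
    (lieGramC B).det ≠ 0 ↔ lieGramDetC N Jw ≠ 0 := by
  haveI : FiniteDimensional ℝ (Matrix (Fin N) (Fin N) ℂ) := finiteDimensional_matrixC
  set B₀ := lieFinBasisC N Jw with hB₀
  let eι : Fin (Module.finrank ℝ (skewC N Jw)) ≃ ι := B₀.indexEquiv B
  set B₁ : Module.Basis ι ℝ (skewC N Jw) := B₀.reindex eι with hB₁
  have hG : (lieGramC B₁).det = lieGramDetC N Jw := by
    have : lieGramC B₁ = Matrix.reindex eι eι (lieGramC B₀) := by
      ext i j; simp only [lieGramC_apply, hB₁, Module.Basis.reindex_apply, Matrix.reindex_apply, Matrix.submatrix_apply]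
    rw [this, Matrix.det_reindex_self]; rfl
  set P := B₁.toMatrix B with hP
  have hGB : (lieGramC B).det = P.det ^ 2 * (lieGramC B₁).det := by
    rw [lieGramC_basis_change B₁ B, Matrix.det_mul, Matrix.det_mul, Matrix.det_transpose]; ring
  have hP0 : P.det ≠ 0 := by rw [hP, ← B₁.det_apply B]; exact (B₁.isUnit_det B).ne_zero
  rw [hGB, ← hG, mul_ne_zero_iff]
  exact ⟨fun h => h.2, fun h => ⟨pow_ne_zero 2 hP0, h⟩⟩

/-- Under a congruence the trace forms on `𝔲(J)` and `𝔲(J₂)` are non-degenerate together. [cite: Macdonald1980, p. 93] -/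
theorem lieGramDetC_ne_zero_iff_of_conj {T : GL (Fin N) ℂ} (e : skewC N Jw₂ ≃L[ℝ] skewC N Jw)
    (he : ∀ X : skewC N Jw₂, ((e X : skewC N Jw) : Matrix (Fin N) (Fin N) ℂ) = (T : Matrix (Fin N) (Fin N) ℂ) * (X : Matrix (Fin N) (Fin N) ℂ) * ((T⁻¹ : GL (Fin N) ℂ) : Matrix (Fin N) (Fin N) ℂ)) :
    lieGramDetC N Jw ≠ 0 ↔ lieGramDetC N Jw₂ ≠ 0 := by
  have h1 := det_lieGramC_ne_zero_iff ((lieFinBasisC N Jw₂).map e.toLinearEquiv)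
  have h2 := det_lieGramC_ne_zero_iff (lieFinBasisC N Jw₂)
  rw [lieGramC_map_conjEquiv e he] at h1
  exact h1.symm.trans h2

variable [MeasurableSpace (skewC N Jw)] [BorelSpace (skewC N Jw)] [MeasurableSpace (skewC N Jw₂)] [BorelSpace (skewC N Jw₂)]

/-- **`Ad T` CARRIES THE CANONICAL LEBESGUE MEASURE OF `𝔲(J₂)` TO THAT OF `𝔲(J)`**: `e_* λ_{J₂} = λ_J` (`e_*(B.addHaar) = (e ∘ B).addHaar`, Mathlib `Module.Basis.map_addHaar`, and
the Gram determinant of `e ∘ B` is that of `B`) — «`(Ad T)^* ω_std = ω_std`». [cite: Macdonald1980, p. 93] [cite: Rogawski1990, §1.7 p. 6] -/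
theorem map_conjEquiv_lieStdLebesgueC {T : GL (Fin N) ℂ} (e : skewC N Jw₂ ≃L[ℝ] skewC N Jw)
    (he : ∀ X : skewC N Jw₂, ((e X : skewC N Jw) : Matrix (Fin N) (Fin N) ℂ) = (T : Matrix (Fin N) (Fin N) ℂ) * (X : Matrix (Fin N) (Fin N) ℂ) * ((T⁻¹ : GL (Fin N) ℂ) : Matrix (Fin N) (Fin N) ℂ)) :
    Measure.map e (lieStdLebesgueC N Jw₂) = lieStdLebesgueC N Jw := by
  haveI : FiniteDimensional ℝ (Matrix (Fin N) (Fin N) ℂ) := finiteDimensional_matrixC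
  have h1 : Measure.map e (lieFinBasisC N Jw₂).addHaar = ((lieFinBasisC N Jw₂).map e.toLinearEquiv).addHaar := Module.Basis.map_addHaar _ e
  have h2 := lieStdLebesgueC_eq_smul_addHaar ((lieFinBasisC N Jw₂).map e.toLinearEquiv)
  rw [lieGramC_map_conjEquiv e he] at h2
  rw [lieStdLebesgueC_def, Measure.map_smul, h1]
  convert h2.symm

/-- **THE WINDOW-FREE INTEGRAL IDENTITY**: `∫⁻_{𝔲(J)} w₀^J dλ_J = ∫⁻_{𝔲(J₂)} w₀^{J₂} dλ_{J₂}` for congruent `J, J₂` (change of variables along `Ad T`: `e_* λ_{J₂} = λ_J`,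
`w₀^J ∘ e = w₀^{J₂}`).  With «`vol^TF = ∫⁻ w₀ dλ`» (U4-discharge piece (ii)) this is the congruence invariance of the top-form VOLUME. [cite: Macdonald1980, p. 93] [cite: Rogawski1990, §1.7 p. 6] -/
theorem lintegral_cayleyWeightC_eq_of_conj {T : GL (Fin N) ℂ} (e : skewC N Jw₂ ≃L[ℝ] skewC N Jw)
    (he : ∀ X : skewC N Jw₂, ((e X : skewC N Jw) : Matrix (Fin N) (Fin N) ℂ) = (T : Matrix (Fin N) (Fin N) ℂ) * (X : Matrix (Fin N) (Fin N) ℂ) * ((T⁻¹ : GL (Fin N) ℂ) : Matrix (Fin N) (Fin N) ℂ)) :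
    ∫⁻ X, ENNReal.ofReal (cayleyWeightC N Jw X) ∂(lieStdLebesgueC N Jw) = ∫⁻ X, ENNReal.ofReal (cayleyWeightC N Jw₂ X) ∂(lieStdLebesgueC N Jw₂) := by
  set em : skewC N Jw₂ ≃ᵐ skewC N Jw := e.toHomeomorph.toMeasurableEquiv with hem_def
  have hem : (⇑em : skewC N Jw₂ → skewC N Jw) = ⇑e := rfl
  rw [← map_conjEquiv_lieStdLebesgueC e he, ← hem, lintegral_map_equiv]
  refine lintegral_congr fun X => ?_
  rw [hem, cayleyWeightC_conj e he]

/-- The same over the Cayley sources (which correspond under `Ad T`): `∫⁻_{source(J)} w₀^J dλ_J = ∫⁻_{source(J₂)} w₀^{J₂} dλ_{J₂}`. [cite: Macdonald1980, p. 93] [cite: Rogawski1990, §1.7 p. 6] -/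
theorem setLIntegral_cayleyWeightC_cayleySourceC_eq_of_conj {T : GL (Fin N) ℂ} (e : skewC N Jw₂ ≃L[ℝ] skewC N Jw)
    (he : ∀ X : skewC N Jw₂, ((e X : skewC N Jw) : Matrix (Fin N) (Fin N) ℂ) = (T : Matrix (Fin N) (Fin N) ℂ) * (X : Matrix (Fin N) (Fin N) ℂ) * ((T⁻¹ : GL (Fin N) ℂ) : Matrix (Fin N) (Fin N) ℂ)) :
    ∫⁻ X in cayleySourceC N Jw, ENNReal.ofReal (cayleyWeightC N Jw X) ∂(lieStdLebesgueC N Jw) =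
      ∫⁻ X in cayleySourceC N Jw₂, ENNReal.ofReal (cayleyWeightC N Jw₂ X) ∂(lieStdLebesgueC N Jw₂) := by
  set em : skewC N Jw₂ ≃ᵐ skewC N Jw := e.toHomeomorph.toMeasurableEquiv with hem_def
  have hem : (⇑em : skewC N Jw₂ → skewC N Jw) = ⇑e := rfl
  have hpre : ⇑em ⁻¹' cayleySourceC N Jw = cayleySourceC N Jw₂ := by
    rw [hem, ← image_conjEquivC_cayleySourceC e he, e.injective.preimage_image]
  rw [← map_conjEquiv_lieStdLebesgueC e he, ← hem, em.restrict_map, lintegral_map_equiv, hpre]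
  refine lintegral_congr fun X => ?_
  rw [hem, cayleyWeightC_conj e he]

/-- **CONGRUENCE INVARIANCE OF THE TOP-FORM VOLUME, hypothesis form**: if the total masses of `localTopFormHaar` are the source integrals of the weights (U4-discharge piece (ii),
for `J` and `J₂`), then congruent `J, J₂` have the SAME top-form volume. [cite: Rogawski1990, §1.7 p. 6] [cite: Macdonald1980, p. 93] -/
theorem localTopFormHaar_univ_eq_of_conj_of_mass [MeasurableSpace (GL (Fin N) ℂ)] [BorelSpace (GL (Fin N) ℂ)] {T : GL (Fin N) ℂ}
    (h : formCongr (starRingEnd ℂ) T Jw = Jw₂)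
    (hmass : localTopFormHaar N Jw Set.univ = ∫⁻ X in cayleySourceC N Jw, ENNReal.ofReal (cayleyWeightC N Jw X) ∂(lieStdLebesgueC N Jw))
    (hmass₂ : localTopFormHaar N Jw₂ Set.univ = ∫⁻ X in cayleySourceC N Jw₂, ENNReal.ofReal (cayleyWeightC N Jw₂ X) ∂(lieStdLebesgueC N Jw₂)) :
    localTopFormHaar N Jw Set.univ = localTopFormHaar N Jw₂ Set.univ := by
  obtain ⟨e, he⟩ := exists_conjEquivC (Jw := Jw) (Jw₂ := Jw₂) h
  rw [hmass, hmass₂, setLIntegral_cayleyWeightC_cayleySourceC_eq_of_conj e he]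

end Ad

end UnitaryArchLocalTopForm

end Literature.NumberTheory.Weil1964

end
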